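import Summits.AtomisticToContinuum.HydrodynamicLimit.Theorems.CollisionIsometryCLTMacroClosureStubClausiusLimits
import HarnessLib

/-!
# Stub `stub_clausius_for` of the line `IdeatorTwoGen1Sketch` (crux `MacroClosure`, stmt-14870):
# kernel-parametrised Clausius in mean on the good event, conditionally on Ruelle convexity

Proof file (`--supports stmt-AtomisticToContinuum-14870`) for the registered kernel-parametrised
conditional stub
`stub_clausius_for : StiffCollisionalRelaxation.HsFreeEnergyConvex → ∀ (γ C : ℝ) (φ : ℕ → T3 → ℝ),
  BlockMGFFor γ C φ → InitialEntropyValue → ClausiusInMeanFor γ C φ`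
of the reshaped skeleton (the statics bill `BlockMGFFor` is now paid for ONE admissible kernel family).
The proof is the family-wise assembly of `stub_clausius_of_hsFreeEnergyConvex`
(`…StubClausius.lean`) with the block MGF consumed at the fixed family: thresholds
`σ < min(σ_M(γ,C,φ), σ_I, σ₂)`; `U_c = stateOf 1 0 1`; tilt `γ' ↑ 1`, `ε = γ'δ/4`; the fixed-`N`, fixed-`s`
bound `Clausius.core_bound`; `KL(P‖G_N)/(N+1) → ∫ h_σ(U_cl(0)|U_c)` (`InitialEntropyValue` with the pinned
data of `Clausius.identify`); the good-event functional in mean (`Clausius.tendsto_goodFunctional`); the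
continuum telescope (`Clausius.telescope_continuum`). The open item `HsFreeEnergyConvex` (stmt-9526) enters
only through `Clausius.continuousOn_hsExcessFreeEnergy` (continuity of `f_ex` on `(0, 1.1)`, needed for the
`x`-integrability of the block entropy functional on band configurations, packings up to `1`).
-/

noncomputable section

open MeasureTheory Filter Set Topology InformationTheory
open scoped ENNReal ContDiff

namespace Summit.AtomisticToContinuum.HydrodynamicLimit.Theorems.MacroClosureLine

open Literature.MathematicalPhysics.KineticTheory Literature.Analysis.FluidPDE
open Literature.Analysis.FunctionSpaces
open Summit.AtomisticToContinuum.HydrodynamicLimit.Theses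

namespace Barycentric

open Clausius in
/-- **`stub_clausius_for` (registered kernel-parametrised conditional stub):** for ONE kernel family
`(γ, C, φ)`, Clausius in mean on the good event, uniformly in time, from the block MGF of that family and
the initial entropy value, GIVEN Ruelle convexity of the hard-sphere free energy (used only for the
continuity of `f_ex` on the band packings). [folklore] -/
theorem stub_clausius_for : StiffCollisionalRelaxation.HsFreeEnergyConvex → ∀ (γ C : ℝ) (φ : ℕ → T3 → ℝ), BlockMGFFor γ C φ → InitialEntropyValue → ClausiusInMeanFor γ C φ := by
  intro hH γ C φ hM hI a₀ θ₀ u₀ ha hθ hu ha0 hθ0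
  obtain ⟨σM, hσM, HM⟩ := hM
  obtain ⟨σI, hσI, HI⟩ := hI a₀ θ₀ u₀ ha hθ hu ha0 hθ0
  obtain ⟨σ₂, hσ₂, hσ₂2, H2⟩ := identify a₀ θ₀ u₀ ha hθ hu ha0 hθ0
  refine ⟨min σM (min σI σ₂), lt_min hσM (lt_min hσI hσ₂), fun σ hσ hσlt => ?_⟩
  have hσM' : σ < σM := lt_of_lt_of_le hσlt (min_le_left _ _)
  have hσI' : σ < σI := lt_of_lt_of_le hσlt ((min_le_right _ _).trans (min_le_left _ _))
  have hσ₂' : σ < σ₂ := lt_of_lt_of_le hσlt ((min_le_right _ _).trans (min_le_right _ _))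
  have hσhalf : σ ≤ 1 / 2 := (hσ₂'.trans_le hσ₂2).le
  have hσ3 : 0 < σ ^ 3 := pow_pos hσ 3
  intro T ρ θ u hE Φ hT hγ hγ15 hφA c₁ t₁ hc₁ ht₁ ht₁T G hGm hGgood hGband hGc δ hδ
  have hT0 : 0 < T := ht₁.trans ht₁T
  have h0T : (0 : ℝ) ∈ Ico 0 T := ⟨le_rfl, hT0⟩
  have h0t : (0 : ℝ) ∈ Icc 0 t₁ := ⟨le_rfl, ht₁.le⟩
  obtain ⟨huu, hθθ, hpack, hmass, hdens⟩ := H2 σ hσ hσ₂' T ρ θ u hE hT0 Φ hT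
  have hφs : ∀ N, Torus.IsSmooth (φ N) := hφA.1
  have hφ0 : ∀ N y, 0 ≤ φ N y := hφA.2.1
  have hφ1 : ∀ N, ∫ y, φ N y = 1 := hφA.2.2.1
  have hφb : ∀ (N : ℕ) y, φ N y ≤ C * ((N : ℝ) + 1) ^ (3 * γ) := hφA.2.2.2.2.1
  set P : (N : ℕ) → Measure (Config (N + 1) (Fin 3) T3) := fun N => localGibbsLaw σ a₀ u₀ θ₀ N (Φ N) with hP
  haveI hPprob : ∀ N, IsProbabilityMeasure (P N) := fun N =>
    isProbabilityMeasure_localGibbsLaw ha hθ hu ha0 hθ0 hσhalf N (Φ N)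
  -- WLOG the band is non-empty: `c₁ σ³ ≤ 1`
  by_cases hc₁σ : c₁ * σ ^ 3 ≤ 1
  swap
  · exfalso
    have hGempty : ∀ N, G N = ∅ := by
      intro N
      ext z
      simp only [mem_empty_iff_false, iff_false]
      intro hz
      obtain ⟨h1, h2⟩ := hGband N z hz 0 h0t 0
      exact hc₁σ ((mul_le_mul_of_nonneg_right h1 hσ3.le).trans h2)
    have h1 : Tendsto (fun _ : ℕ => (1 : ℝ≥0∞)) atTop (𝓝 0) := by
      refine hGc.congr fun N => ?_
      simp only [hGempty N, compl_empty, measure_univ]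
    have := tendsto_nhds_unique h1 tendsto_const_nhds
    exact zero_ne_one this
  -- data at `t = 0`
  have hρc : Continuous (ρ 0) := (hE.smooth_density.isSmooth_slice h0T).continuous
  have huc : Continuous (u 0) := (hE.smooth_velocity.isSmooth_slice h0T).continuous
  have hθc : Continuous (θ 0) := (hE.smooth_temperature.isSmooth_slice h0T).continuous
  have hρpos : ∀ x, 0 < ρ 0 x := hE.density_pos 0 h0T
  have hθpos : ∀ x, 0 < θ 0 x := hE.temperature_pos 0 h0T
  have hfexO := continuousOn_hsExcessFreeEnergy hH
  have hfex : ContinuousOn hsExcessFreeEnergy (Icc (c₁ * σ ^ 3) 1) :=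
    hfexO.mono fun r hr => ⟨(mul_pos hc₁ hσ3).trans_le hr.1, hr.2.trans_lt (by norm_num)⟩
  -- the homogeneous state, the entropy variable and the limits
  set Uc : State := stateOf 1 (0 : V3) 1 with hUc
  set H₀ : ℝ := ∫ x, relEnt σ (stateOf (ρ 0 x) (u 0 x) (θ 0 x)) Uc with hH₀
  set P₀ : V3 := ∫ x, ((fun _ : T3 => (1 : ℝ)) x * ρ 0 x) • u 0 x with hP₀
  set E₀ : ℝ := ∫ x, (fun _ : T3 => (1 : ℝ)) x * totalEnergyDensity (ρ 0 x) (u 0 x) (θ 0 x) with hE₀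
  set Sinf : ℝ := hsEntropy σ Uc + fderiv ℝ (hsEntropy σ) Uc ((((1 : ℝ), P₀, E₀) : State) - Uc) with hSinf
  -- the continuum telescope `∫ η(U_cl(0)) = H₀ + Sinf`
  have htelescope : ∫ x, hsEntropy σ (stateOf (ρ 0 x) (u 0 x) (θ 0 x)) = H₀ + Sinf := by
    have h := telescope_continuum hσ hfexO hρc huc hθc hρpos hθpos hpack hmass Uc
    have hP₀' : (∫ x, ρ 0 x • u 0 x) = P₀ := by simp only [hP₀, one_mul]
    have hE₀' : (∫ x, totalEnergyDensity (ρ 0 x) (u 0 x) (θ 0 x)) = E₀ := by simp only [hE₀, one_mul]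
    rw [h, hP₀', hE₀', hSinf, hH₀]
    ring
  -- parameters `γ'` and `ε`
  obtain ⟨hγ'half, hγ'1, hγ'gap⟩ := tilt_bounds H₀ δ hδ
  set γ' : ℝ := max (1 / 2) (1 - δ / (8 * (|H₀| + 1))) with hγ'
  have hγ'0 : 0 < γ' := lt_of_lt_of_le (by norm_num) hγ'half
  set ε : ℝ := γ' * δ / 4 with hε
  have hε0 : 0 < ε := by positivity
  -- the homogeneous laws
  set Gm : (N : ℕ) → Measure (Config (N + 1) (Fin 3) T3) :=
    fun N => localGibbsLaw σ (fun _ => 1) (fun _ => (0 : V3)) (fun _ => 1) N (Φ N) with hGmdef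
  -- (1) the block MGF, for all flows
  have hev1 := HM σ hσ hσM' (0 : V3) 1 one_pos hγ hγ15 hφA c₁ hc₁ γ' hγ'0 hγ'1 ε hε0
  -- (2) the initial entropy value
  have hev2 : ∀ᶠ N : ℕ in atTop, (klDiv (P N) (Gm N)).toReal / ((N : ℝ) + 1) < H₀ + δ / 8 := by
    have h := HI σ hσ hσI' (0 : V3) 1 one_pos (ρ 0) hρc hρpos Φ hdens
    have hH₀' : (∫ x, relEnt σ (stateOf (ρ 0 x) (u₀ x) (θ₀ x)) (stateOf 1 (0 : V3) 1)) = H₀ := by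
      simp only [hH₀, hUc, ← huu, ← hθθ]
    rw [hH₀'] at h
    exact (tendsto_order.1 h).2 _ (by linarith)
  -- (3) the good-event functional in mean
  have hev3 : ∀ᶠ N : ℕ in atTop, dist (∫ z, (G N).indicator (fun z => hsEntropy σ Uc +
      fderiv ℝ (hsEntropy σ) Uc ((((1 : ℝ), empiricalMomentumField z (fun _ => (1 : ℝ)),
        empiricalEnergyField z (fun _ => (1 : ℝ))) : State) - Uc)) z ∂P N) Sinf < δ / 4 := by
    have hmom : ∀ δ' : ℝ, 0 < δ' → Tendsto (fun N => P N
        {z | δ' < ‖empiricalMomentumField z (fun _ => (1 : ℝ)) - P₀‖}) atTop (𝓝 0) := fun δ' hδ' =>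
      ((hT (fun _ => (1 : ℝ)) continuous_const δ' hδ').2.1).congr fun N =>
        localGibbsLaw_setOf_flow_zero a₀ u₀ θ₀ N (Φ N)
          (fun w => δ' < ‖empiricalMomentumField w (fun _ => (1 : ℝ)) - P₀‖)
    have hen : ∀ δ' : ℝ, 0 < δ' → Tendsto (fun N => P N
        {z | δ' < |empiricalEnergyField z (fun _ => (1 : ℝ)) - E₀|}) atTop (𝓝 0) := fun δ' hδ' =>
      ((hT (fun _ => (1 : ℝ)) continuous_const δ' hδ').2.2).congr fun N =>
        localGibbsLaw_setOf_flow_zero a₀ u₀ θ₀ N (Φ N)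
          (fun w => δ' < |empiricalEnergyField w (fun _ => (1 : ℝ)) - E₀|)
    have hlim := tendsto_goodFunctional hσhalf ha hθ hu ha0 hθ0 Φ Uc P₀ E₀ hmom hen hGm hGc
    exact hlim.eventually (Metric.ball_mem_nhds _ (by positivity))
  -- (4) two particles per block
  have hev4 := eventually_kernel_lt (C := C) (γ := γ) (by linarith) hc₁
  -- assembly
  filter_upwards [hev1, hev2, hev3, hev4] with N h1 h2 h3 h4
  intro s hs
  obtain ⟨hint, hbound⟩ := core_bound hσ hσhalf ha hθ hu ha0 hθ0 (0 : V3) one_pos (Φ N) hc₁ hc₁σ hfex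
    (hφs N).continuous (hφ0 N) (hφ1 N) (hφb N) h4 hγ'0 (ε := ε) (h1 (Φ N)) (hGm N) (hGgood N) s
    (fun z hz x => hGband N z hz s hs x)
  refine ⟨hint, hbound.trans ?_⟩
  -- arithmetic
  have hN0 : (0 : ℝ) < (N : ℝ) + 1 := by positivity
  set K : ℝ := (klDiv (P N) (Gm N)).toReal / ((N : ℝ) + 1) with hK
  have hK' : (klDiv (P N) (Gm N)).toReal = K * ((N : ℝ) + 1) := by rw [hK]; field_simp
  have hterm1 : (γ' * ((N : ℝ) + 1))⁻¹ * ((klDiv (P N) (Gm N)).toReal + ε * ((N : ℝ) + 1)) =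
      γ'⁻¹ * K + δ / 4 := by
    rw [hK', hε]
    field_simp
    try ring
  have hinvγ : γ'⁻¹ ≤ 2 := by
    rw [inv_le_comm₀ hγ'0 two_pos]; linarith
  have hinvγ1 : 0 ≤ γ'⁻¹ - 1 := by
    rw [sub_nonneg, one_le_inv₀ hγ'0]; exact hγ'1.le
  have hterm2 : γ'⁻¹ * K ≤ H₀ + δ / 4 + δ / 4 := by
    have hK8 : K < H₀ + δ / 8 := h2
    have h1' : γ'⁻¹ * K ≤ γ'⁻¹ * (H₀ + δ / 8) :=
      mul_le_mul_of_nonneg_left hK8.le (inv_nonneg.2 hγ'0.le)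
    have h2' : γ'⁻¹ * H₀ ≤ H₀ + δ / 4 := by
      have e1 : γ'⁻¹ * H₀ = H₀ + H₀ * (γ'⁻¹ - 1) := by ring
      rw [e1]
      have : H₀ * (γ'⁻¹ - 1) ≤ |H₀| * (γ'⁻¹ - 1) := mul_le_mul_of_nonneg_right (le_abs_self _) hinvγ1
      linarith [hγ'gap]
    have h3' : γ'⁻¹ * (δ / 8) ≤ δ / 4 := by nlinarith [hinvγ, hδ]
    calc γ'⁻¹ * K ≤ γ'⁻¹ * (H₀ + δ / 8) := h1'
      _ = γ'⁻¹ * H₀ + γ'⁻¹ * (δ / 8) := by ring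
      _ ≤ H₀ + δ / 4 + δ / 4 := by linarith
  have hterm3 : ∫ z, (G N).indicator (fun z => hsEntropy σ Uc +
      fderiv ℝ (hsEntropy σ) Uc ((((1 : ℝ), empiricalMomentumField z (fun _ => (1 : ℝ)),
        empiricalEnergyField z (fun _ => (1 : ℝ))) : State) - Uc)) z ∂P N ≤ Sinf + δ / 4 := by
    have := h3
    rw [Real.dist_eq, abs_lt] at this
    linarith [this.2]
  rw [htelescope]
  calc (γ' * ((N : ℝ) + 1))⁻¹ * ((klDiv (P N) (Gm N)).toReal + ε * ((N : ℝ) + 1)) +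
        ∫ z, (G N).indicator (fun z => hsEntropy σ Uc +
          fderiv ℝ (hsEntropy σ) Uc ((((1 : ℝ), empiricalMomentumField z (fun _ => (1 : ℝ)),
            empiricalEnergyField z (fun _ => (1 : ℝ))) : State) - Uc)) z ∂P N
      = γ'⁻¹ * K + δ / 4 + ∫ z, (G N).indicator (fun z => hsEntropy σ Uc +
          fderiv ℝ (hsEntropy σ) Uc ((((1 : ℝ), empiricalMomentumField z (fun _ => (1 : ℝ)),
            empiricalEnergyField z (fun _ => (1 : ℝ))) : State) - Uc)) z ∂P N := by rw [hterm1]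
    _ ≤ H₀ + δ / 4 + δ / 4 + δ / 4 + (Sinf + δ / 4) := by linarith
    _ = H₀ + Sinf + δ := by ring

end Barycentric

end Summit.AtomisticToContinuum.HydrodynamicLimit.Theorems.MacroClosureLine

end
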